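import Literature.Computability.AlgebraicComplexity.MoreAsymConstituentStructure
import Literature.Computability.AlgebraicComplexity.MoreAsymHashedZeroOutHoles
import Literature.Computability.AlgebraicComplexity.ConstituentStageAssembly
import HarnessLib

/-!
# The more asymmetric constituent stage, one region, assembled in exact form: the input `ε`-interface
tensor restricts to independent copies of `𝒯*`
(Alman–Duan–Vassilevska Williams–Xu–Xu–Zhou 2025, Prop. 6.3 / §6.5–§6.6, one region) — proved

Topic `Literature/Computability/AlgebraicComplexity`.  Alman–Duan–Vassilevska Williams–Xu–Xu–Zhou,
*More asymmetry yields faster matrix multiplication* (SODA 2025, arXiv:2404.16349), §6.5–§6.6: the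
subtensor of `𝒯_ZUseful` over each triple of `𝒯_hash` is `𝒯*` up to holes of three kinds (missing input
blocks; `Y`-holes; `Z`-holes), the fraction of holes is small with constant probability, "and by Theorem 4.2
we can fix the holes" — the first region of **Proposition 6.3**.  This file PROVES the assembly in EXACT
(non-asymptotic) form for the data `D : ConstituentRegion c n s M` of one region, exactly as
`ConstituentStageAssembly.lean` does for VXXZ's Prop. 6.2 (whose relabelling lemma
`brokenStar_restrictsTo_refStar` — three hole sets — and class-size lemma
`letterCount_pairTermIdx_eq_of_consistent` are reused):

* `firstTypeHolesY_union_holesY`, `firstTypeHolesZ_union_holesZ` — second-kind holes outside the input are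
  first-kind holes, so only the holes inside the input (`∩ admY`, `∩ admZ`) need to be counted;
* `input_restrictsTo_copies₂` — **for every `k, r` with `k · r ≤ #{T ∈ 𝒯_hash(ω) | |holesY ∩ input| ≤ h_Y,
  |holesZ ∩ input| ≤ h_Z}`, `r ≥ 8^{3⌊log_{2N} 3^N⌋+3}` (`N = c · 2n`) and hole budgets
  `8 N |firstTypeHolesX(T)| ≤ M_X`, `8 N (|firstTypeHolesY(T)| + h_Y) ≤ M_Y`, `8 N (|firstTypeHolesZ(T)| + h_Z) ≤ M_Z`:
  `𝒯_{τ,L,ε} ≥ ⟨k⟩ ⊗ 𝒯*`** — the zero-outs (`input_restrictsTo_directSum₂`), `k` batches of `r` good broken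
  copies (`summand_eq_brokenStar₂`), relabelling, and Thm. 4.2 (`vxxz2024_cor42`, holes in all three
  dimensions) on each batch;
* `advxxz2025_prop63_region` — with the good seed of `MoreAsymHashedZeroOutHoles.lean` (Lemma 6.7, Claim 6.21,
  Markov) under the requirements on `M` (`8 numtriple ≤ M numxblock`; `10 U_Y(T) M^{2n−1} ≤ (h_Y+1) M^{2n}`,
  `10 U_Z(T) M^{2n−1} ≤ (h_Z+1) M^{2n}`): **`𝒯_{τ,L,ε} ≥ ⟨⌊|B| · numalpha / (2 M² r)⌋⟩ ⊗ 𝒯*`** — the printed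
  "`numalpha · M^{−1−o(1)}` unbroken copies of `𝒯*`" with all constants explicit.

Everything is proved; one abbreviation (`goodTriples₂`); no named facts.  The six-region product
(Claim 6.5) and the exponents `E_r` of Prop. 6.3 are not treated here.

## References

* J. Alman, R. Duan, V. Vassilevska Williams, Y. Xu, Z. Xu, R. Zhou, *More asymmetry yields faster
  matrix multiplication*, SODA 2025, arXiv:2404.16349 (held: `paper:arxiv-2404.16349`, chunks p0022,
  p0024–p0026): Prop. 6.3, §6.5 (the three kinds of holes), §6.6 (Summary), Thm. 4.2.
  [AlmanDuanVassilevskaWilliamsXuXuZhou2025]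
* V. Vassilevska Williams, Y. Xu, Z. Xu, R. Zhou, *New bounds for matrix multiplication: from alpha
  to omega*, SODA 2024, arXiv:2307.07970, Prop. 6.2, §6.6, Cor. 4.2. [VassilevskaWilliamsXuXuZhou2024]
-/

noncomputable section

open scoped BigOperators
open Finset

namespace Literature.Computability.AlgebraicComplexity

open Literature.Barriers.MatrixMultiplication (bigCwTensor)

universe u

namespace ConstituentRegion

open scoped Classical

variable {c n s M : ℕ} {D : ConstituentRegion c n s M}

variable (D) in
/-- **The good copies**: triples of `𝒯_hash` whose copy of `𝒯*` has at most `h_Y` `Y`-holes and at most `h_Z`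
`Z`-holes of the second kind inside the input. [cite: AlmanDuanVassilevskaWilliamsXuXuZhou2025, §6.5 ("the fraction of holes is small")] -/
abbrev goodTriples₂ (ω : VxxzSeed M (n + n)) (hY hZ : ℕ) :
    Finset ((Fin (n + n) → Fin (2 * c + 1)) × (Fin (n + n) → Fin (2 * c + 1)) × (Fin (n + n) → Fin (2 * c + 1))) :=
  (D.toMoreAsymHashed.present ω).filter fun T =>
    (D.toMoreAsymHashed.holesY ω T ∩ D.admY).card ≤ hY ∧ (D.toMoreAsymHashed.holesZ ω T ∩ D.admZ).card ≤ hZ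

/-- **`Y`-holes of the second kind outside the input are first-kind holes.** [cite: AlmanDuanVassilevskaWilliamsXuXuZhou2025, §6.5 (the three kinds of holes)] -/
theorem firstTypeHolesY_union_holesY {ω : VxxzSeed M (n + n)} (T : ↥(D.toMoreAsymHashed.present ω))
    (hT : IsLevelTriple c (seqVal T.1.1) (seqVal T.1.2.1) (seqVal T.1.2.2)) :
    firstTypeHolesY D.τ D.L D.ε hT D.βX D.βY D.βZ ∪ D.toMoreAsymHashed.holesY ω T.1 =
      firstTypeHolesY D.τ D.L D.ε hT D.βX D.βY D.βZ ∪ (D.toMoreAsymHashed.holesY ω T.1 ∩ D.admY) := by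
  ext Jh
  simp only [mem_union, mem_inter]
  constructor
  · rintro (hF | hH)
    · exact Or.inl hF
    · by_cases hA : Jh ∈ D.admY
      · exact Or.inr ⟨hH, hA⟩
      · left
        rw [MoreAsymHashedZeroOut.holesY, mem_filter] at hH
        obtain ⟨-, hblk, hu, -⟩ := hH
        rw [firstTypeHolesY, mem_filter, mem_levelBlocksY_pair_iff D.τ hT, chunkLevels_eq_iff]
        exact ⟨⟨hblk, hu⟩, fun hm => hA ((mem_admY D).2 hm)⟩
  · rintro (hF | ⟨hH, -⟩)
    · exact Or.inl hF
    · exact Or.inr hH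

/-- **`Z`-holes of the second kind outside the input are first-kind holes.** [cite: AlmanDuanVassilevskaWilliamsXuXuZhou2025, §6.5] -/
theorem firstTypeHolesZ_union_holesZ {ω : VxxzSeed M (n + n)} (T : ↥(D.toMoreAsymHashed.present ω))
    (hT : IsLevelTriple c (seqVal T.1.1) (seqVal T.1.2.1) (seqVal T.1.2.2)) :
    firstTypeHolesZ D.τ D.L D.ε hT D.βX D.βY D.βZ ∪ D.toMoreAsymHashed.holesZ ω T.1 =
      firstTypeHolesZ D.τ D.L D.ε hT D.βX D.βY D.βZ ∪ (D.toMoreAsymHashed.holesZ ω T.1 ∩ D.admZ) := by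
  ext Kh
  simp only [mem_union, mem_inter]
  constructor
  · rintro (hF | hH)
    · exact Or.inl hF
    · by_cases hA : Kh ∈ D.admZ
      · exact Or.inr ⟨hH, hA⟩
      · left
        rw [MoreAsymHashedZeroOut.holesZ, mem_filter] at hH
        obtain ⟨-, hblk, hu, -⟩ := hH
        rw [firstTypeHolesZ, mem_filter, mem_levelBlocksZ_pair_iff D.τ hT, chunkLevels_eq_iff]
        exact ⟨⟨hblk, hu⟩, fun hm => hA ((mem_admZ D).2 hm)⟩
  · rintro (hF | ⟨hH, -⟩)
    · exact Or.inl hF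
    · exact Or.inr hH

variable (R : Type u) [CommSemiring R] (q : ℕ)

/-- **The input restricts to `k` independent copies of `𝒯*`** (§6.5–§6.6 in exact form): if
`k · r ≤ #{T ∈ 𝒯_hash(ω) | second-kind holes inside the input ≤ h_Y, h_Z}`, `r ≥ 8^{3⌊log_{2N} 3^N⌋+3}`
(`N = c · 2n`) and, for every `{α_t}`-consistent triple, the first-kind holes (plus `h_Y`, `h_Z` in the `Y`-,
`Z`-dimensions) are within the budget `1/(8N)` of the level-1 blocks of the reference `𝒯*`, then
`𝒯_{τ,L,ε} ≥ ⟨k⟩ ⊗ 𝒯*`. [cite: AlmanDuanVassilevskaWilliamsXuXuZhou2025, §6.5 ("by Theorem 4.2 we can fix the holes") and Prop. 6.3] -/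
theorem input_restrictsTo_copies₂ (hD : D.MoreAsymWellFormed) (hc : 0 < c) (hn : 0 < n) (ω : VxxzSeed M (n + n)) {hY hZ k r : ℕ}
    (hr : 8 ^ (3 * Nat.log (2 * (c * (n + n))) (3 ^ (c * (n + n))) + 3) ≤ r)
    (hkr : k * r ≤ (D.goodTriples₂ ω hY hZ).card)
    {T₀ : (Fin (n + n) → Fin (2 * c + 1)) × (Fin (n + n) → Fin (2 * c + 1)) × (Fin (n + n) → Fin (2 * c + 1))}
    (hT₀ : T₀ ∈ D.consistent) (h₀ : IsLevelTriple c (seqVal T₀.1) (seqVal T₀.2.1) (seqVal T₀.2.2))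
    (hHX : ∀ T ∈ D.consistent, ∀ hT : IsLevelTriple c (seqVal T.1) (seqVal T.2.1) (seqVal T.2.2),
      8 * (c * (n + n)) * (firstTypeHolesX D.τ D.L D.ε hT D.βX D.βY D.βZ).card ≤
        (levelBlocksX (pairTermIdx D.τ h₀) (pairTermList c s D.βX D.βY D.βZ) 0).card)
    (hHY : ∀ T ∈ D.consistent, ∀ hT : IsLevelTriple c (seqVal T.1) (seqVal T.2.1) (seqVal T.2.2),
      8 * (c * (n + n)) * ((firstTypeHolesY D.τ D.L D.ε hT D.βX D.βY D.βZ).card + hY) ≤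
        (levelBlocksY (pairTermIdx D.τ h₀) (pairTermList c s D.βX D.βY D.βZ) 0).card)
    (hHZ : ∀ T ∈ D.consistent, ∀ hT : IsLevelTriple c (seqVal T.1) (seqVal T.2.1) (seqVal T.2.2),
      8 * (c * (n + n)) * ((firstTypeHolesZ D.τ D.L D.ε hT D.βX D.βY D.βZ).card + hZ) ≤
        (levelBlocksZ (pairTermIdx D.τ h₀) (pairTermList c s D.βX D.βY D.βZ) 0).card) :
    TensorRestrictsTo (interfaceTensor R q D.τ D.L D.ε)
      (kroneckerTensor (unitTensor R k) (starTensor₂ D.τ R q h₀ D.βX D.βY D.βZ)) := by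
  have hN : 0 < n + n := by omega
  have hD₀ : D.WellFormed := hD.toWellFormed
  have h12 := input_restrictsTo_directSum₂ R q hD ω
  set g := (D.goodTriples₂ ω hY hZ).card with hg
  let eg : Fin g ≃ ↥(D.goodTriples₂ ω hY hZ) := (Fintype.equivFinOfCardEq (Fintype.card_coe _)).symm
  have hgood_sub : D.goodTriples₂ ω hY hZ ⊆ D.toMoreAsymHashed.present ω := filter_subset _ _
  let j : Fin k × Fin r → ↥(D.goodTriples₂ ω hY hZ) := fun p => eg (Fin.castLE hkr (finProdFinEquiv p))
  have hj : Function.Injective j := fun p p' hpp' =>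
    finProdFinEquiv.injective (Fin.castLE_injective hkr (eg.injective hpp'))
  let ι : Fin k × Fin r → ↥(D.toMoreAsymHashed.present ω) := fun p => ⟨(j p).1, hgood_sub (j p).2⟩
  have hι : Function.Injective ι := by
    intro p p' hpp'
    have h' : (ι p).1 = (ι p').1 := congrArg Subtype.val hpp'
    exact hj (Subtype.ext (show (j p).1 = (j p').1 from h'))
  have hιgood : ∀ p, (ι p).1 ∈ D.goodTriples₂ ω hY hZ := fun p => (j p).2
  have h3 : TensorRestrictsTo (familyDirectSum fun T : ↥(D.toMoreAsymHashed.present ω) => D.toMoreAsymHashed.summand R q ω T)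
      (familyDirectSum fun p : Fin k × Fin r => D.toMoreAsymHashed.summand R q ω (ι p)) :=
    familyDirectSum_reindex _ hι
  have h4 : TensorRestrictsTo (familyDirectSum fun p : Fin k × Fin r => D.toMoreAsymHashed.summand R q ω (ι p))
      (familyDirectSum fun a : Fin k => familyDirectSum fun b : Fin r => D.toMoreAsymHashed.summand R q ω (ι (a, b))) :=
    familyDirectSum_prod fun a b => D.toMoreAsymHashed.summand R q ω (ι (a, b))
  have hcopy : ∀ (a : Fin k) (b : Fin r), ∃ HX₀ HY₀ HZ₀ : Finset (Fin (n + n) → Fin c → Fin 3),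
      8 * (c * (n + n)) * HX₀.card ≤ (levelBlocksX (pairTermIdx D.τ h₀) (pairTermList c s D.βX D.βY D.βZ) 0).card ∧
      8 * (c * (n + n)) * HY₀.card ≤ (levelBlocksY (pairTermIdx D.τ h₀) (pairTermList c s D.βX D.βY D.βZ) 0).card ∧
      8 * (c * (n + n)) * HZ₀.card ≤ (levelBlocksZ (pairTermIdx D.τ h₀) (pairTermList c s D.βX D.βY D.βZ) 0).card ∧
      TensorRestrictsTo (D.toMoreAsymHashed.summand R q ω (ι (a, b)))
        (partSubtensor levelSeq levelSeq levelSeq (starTensor₂ D.τ R q h₀ D.βX D.βY D.βZ) HX₀ᶜ HY₀ᶜ HZ₀ᶜ) := by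
    intro a b
    have hgd := hιgood (a, b)
    obtain ⟨hpres, hholesY, hholesZ⟩ := mem_filter.1 hgd
    have hTα : (ι (a, b)).1 ∈ D.consistent := xPresentTriples_subset hpres
    have hT := present_isLevelTriple₂ hD₀ (ι (a, b))
    obtain ⟨HX₀, HY₀, HZ₀, hcX, hcY, hcZ, hres⟩ := brokenStar_restrictsTo_refStar R q D.τ hT h₀
      (letterCount_pairTermIdx_eq_of_consistent hD₀ hTα hT₀ hT h₀) D.βX D.βY D.βZ
      (firstTypeHolesX D.τ D.L D.ε hT D.βX D.βY D.βZ)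
      (firstTypeHolesY D.τ D.L D.ε hT D.βX D.βY D.βZ ∪ D.toMoreAsymHashed.holesY ω (ι (a, b)).1)
      (firstTypeHolesZ D.τ D.L D.ε hT D.βX D.βY D.βZ ∪ D.toMoreAsymHashed.holesZ ω (ι (a, b)).1)
    refine ⟨HX₀, HY₀, HZ₀, ?_, ?_, ?_, ?_⟩
    · rw [hcX]; exact hHX _ hTα hT
    · rw [hcY, firstTypeHolesY_union_holesY (ι (a, b)) hT]
      calc 8 * (c * (n + n)) * (firstTypeHolesY D.τ D.L D.ε hT D.βX D.βY D.βZ ∪ (D.toMoreAsymHashed.holesY ω (ι (a, b)).1 ∩ D.admY)).card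
          ≤ 8 * (c * (n + n)) * ((firstTypeHolesY D.τ D.L D.ε hT D.βX D.βY D.βZ).card + hY) :=
            Nat.mul_le_mul_left _ ((card_union_le _ _).trans (Nat.add_le_add_left hholesY _))
        _ ≤ _ := hHY _ hTα hT
    · rw [hcZ, firstTypeHolesZ_union_holesZ (ι (a, b)) hT]
      calc 8 * (c * (n + n)) * (firstTypeHolesZ D.τ D.L D.ε hT D.βX D.βY D.βZ ∪ (D.toMoreAsymHashed.holesZ ω (ι (a, b)).1 ∩ D.admZ)).card
          ≤ 8 * (c * (n + n)) * ((firstTypeHolesZ D.τ D.L D.ε hT D.βX D.βY D.βZ).card + hZ) :=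
            Nat.mul_le_mul_left _ ((card_union_le _ _).trans (Nat.add_le_add_left hholesZ _))
        _ ≤ _ := hHZ _ hTα hT
    · rw [summand_eq_brokenStar₂ R q hD (ι (a, b)) hT]
      exact hres
  choose HX₀ HY₀ HZ₀ hHX₀ hHY₀ hHZ₀ hres using hcopy
  have hbatch : ∀ a : Fin k, TensorRestrictsTo (familyDirectSum fun b : Fin r => D.toMoreAsymHashed.summand R q ω (ι (a, b)))
      (starTensor₂ D.τ R q h₀ D.βX D.βY D.βZ) := by
    intro a
    refine (familyDirectSum_mono fun b => hres a b).trans ?_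
    exact vxxz2024_cor42 R q hc hN (pairTermIdx D.τ h₀) (pairTermList c s D.βX D.βY D.βZ)
      (HX₀ a) (HY₀ a) (HZ₀ a) (hHX₀ a) (hHY₀ a) (hHZ₀ a) hr
  have h5 : TensorRestrictsTo
      (familyDirectSum fun a : Fin k => familyDirectSum fun b : Fin r => D.toMoreAsymHashed.summand R q ω (ι (a, b)))
      (kroneckerTensor (unitTensor R k) (starTensor₂ D.τ R q h₀ D.βX D.βY D.βZ)) := by
    rw [← familyDirectSum_const]
    exact familyDirectSum_mono hbatch
  exact h12.trans (h3.trans (h4.trans h5))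

/-- The universe of the more asymmetric stage is a family of level triples. [cite: AlmanDuanVassilevskaWilliamsXuXuZhou2025, §6.2] -/
theorem isLevelFamily_tripleSet₂ : IsLevelFamily (2 * c) D.toMoreAsymHashed.𝒯 :=
  fun _ hT p => levelSum_of_mem_tripleUniverse hT p

variable [Fact M.Prime]

/-- **ADVXXZ Proposition 6.3, one region, exact form.**  Let `D` be well-formed data of one region of the
constituent stage (`MoreAsymWellFormed`), `M` an odd prime with `2c < M`, `n, c ≥ 1`, `B ⊆ ℤ/M` without
non-trivial 3-term progressions, and assume the requirements on `M` of §6.2 and §6.5 in counting form: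
`8 · numtriple ≤ M · numxblock` and, for every `{α_t}`-consistent `T`, `10 U_Y(T) M^{2n−1} ≤ (h_Y+1) M^{2n}`,
`10 U_Z(T) M^{2n−1} ≤ (h_Z+1) M^{2n}` (second-kind holes inside the input, `holePairsYIn admY`,
`holePairsZIn admZ`), together with the hole budgets of Thm. 4.2 for the first-kind holes (plus `h_Y`, `h_Z`).
Then for every `r ≥ 8^{3⌊log_{2N} 3^N⌋+3}` and every reference `{α_t}`-consistent triple `T₀`,
**`𝒯_{τ,L,ε} ≥ ⟨⌊|B| · numalpha / (2 M² r)⌋⟩ ⊗ 𝒯*_{T₀}`** — the printed "`numalpha · M₀^{−1−o(1)}` unbroken copies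
of `𝒯*`" with all constants explicit. [cite: AlmanDuanVassilevskaWilliamsXuXuZhou2025, Prop. 6.3 (one region) and §6.5–§6.6] -/
theorem advxxz2025_prop63_region (hD : D.MoreAsymWellFormed) (hM : M ≠ 2) (hcM : 2 * c < M) (hc : 0 < c) (hn : 0 < n)
    (hB : ThreeAPFree (D.B : Set (ZMod M)))
    (h8X : 8 * D.tripleSet.card ≤ M * (pairTypeClass D.τ D.kX).card) {hY hZ : ℕ}
    (hUY : ∀ T ∈ D.consistent, 10 * ((D.toMoreAsymHashed.holePairsYIn D.admY T).card * M ^ (n + n - 1)) ≤ (hY + 1) * M ^ (n + n))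
    (hUZ : ∀ T ∈ D.consistent, 10 * ((D.toMoreAsymHashed.holePairsZIn D.admZ T).card * M ^ (n + n - 1)) ≤ (hZ + 1) * M ^ (n + n))
    {T₀ : (Fin (n + n) → Fin (2 * c + 1)) × (Fin (n + n) → Fin (2 * c + 1)) × (Fin (n + n) → Fin (2 * c + 1))}
    (hT₀ : T₀ ∈ D.consistent) (h₀ : IsLevelTriple c (seqVal T₀.1) (seqVal T₀.2.1) (seqVal T₀.2.2))
    (hHX : ∀ T ∈ D.consistent, ∀ hT : IsLevelTriple c (seqVal T.1) (seqVal T.2.1) (seqVal T.2.2),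
      8 * (c * (n + n)) * (firstTypeHolesX D.τ D.L D.ε hT D.βX D.βY D.βZ).card ≤
        (levelBlocksX (pairTermIdx D.τ h₀) (pairTermList c s D.βX D.βY D.βZ) 0).card)
    (hHY : ∀ T ∈ D.consistent, ∀ hT : IsLevelTriple c (seqVal T.1) (seqVal T.2.1) (seqVal T.2.2),
      8 * (c * (n + n)) * ((firstTypeHolesY D.τ D.L D.ε hT D.βX D.βY D.βZ).card + hY) ≤
        (levelBlocksY (pairTermIdx D.τ h₀) (pairTermList c s D.βX D.βY D.βZ) 0).card)
    (hHZ : ∀ T ∈ D.consistent, ∀ hT : IsLevelTriple c (seqVal T.1) (seqVal T.2.1) (seqVal T.2.2),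
      8 * (c * (n + n)) * ((firstTypeHolesZ D.τ D.L D.ε hT D.βX D.βY D.βZ).card + hZ) ≤
        (levelBlocksZ (pairTermIdx D.τ h₀) (pairTermList c s D.βX D.βY D.βZ) 0).card)
    {r : ℕ} (hr : 8 ^ (3 * Nat.log (2 * (c * (n + n))) (3 ^ (c * (n + n))) + 3) ≤ r) :
    TensorRestrictsTo (interfaceTensor R q D.τ D.L D.ε)
      (kroneckerTensor (unitTensor R (D.B.card * D.consistent.card / (2 * M ^ 2 * r))) (starTensor₂ D.τ R q h₀ D.βX D.βY D.βZ)) := by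
  have hN : 0 < n + n := by omega
  have hdegX : ∀ T ∈ D.toMoreAsymHashed.𝒯α, 8 * (D.toMoreAsymHashed.𝒯.filter fun T' => T'.1 = T.1).card ≤ M :=
    fun T hT => eight_mul_degX_le h8X (filter_subset _ _ hT)
  obtain ⟨ω, hω⟩ := MoreAsymHashedZeroOut.exists_seed_many_goodIn_copies (moreAsymWellFormed hD) isLevelFamily_tripleSet₂ hM hcM hN
    (by simpa using hB) hdegX D.admY D.admZ (hY := hY) (hZ := hZ) (by simpa using hUY) (by simpa using hUZ)
  refine input_restrictsTo_copies₂ R q hD hc hn ω hr ?_ hT₀ h₀ hHX hHY hHZ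
  rcases Nat.eq_zero_or_pos r with rfl | hrpos
  · simp
  have hMpos : 0 < M := Nat.Prime.pos Fact.out
  have h2M : 0 < 2 * M ^ 2 := by positivity
  have hω' : D.B.card * D.consistent.card ≤ 2 * M ^ 2 * (D.goodTriples₂ ω hY hZ).card := by simpa using hω
  calc D.B.card * D.consistent.card / (2 * M ^ 2 * r) * r
      = D.B.card * D.consistent.card / (2 * M ^ 2) / r * r := by rw [Nat.div_div_eq_div_mul]
    _ ≤ D.B.card * D.consistent.card / (2 * M ^ 2) := Nat.div_mul_le_self _ _
    _ ≤ (D.goodTriples₂ ω hY hZ).card := by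
        rw [Nat.div_le_iff_le_mul_add_pred h2M]
        exact hω'.trans (Nat.le_add_right _ _)

end ConstituentRegion

end Literature.Computability.AlgebraicComplexity
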